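import Mathlib
import HarnessLib
import Literature.MathematicalPhysics.QuantumFieldTheory.Balaban1983to89.B10StarCount
import Literature.MathematicalPhysics.QuantumFieldTheory.Balaban1983to89.B10DagLeaf

/-!
# `Balaban1983to89.B10StarLower` — the reader's item (R2) `B10DagLeaf.StarLower` («s₀|T₁^{(k)}| ≤ |T₁^{(k)*}|»)
DISCHARGED BY NAME from the p. 260 star-bond count of `B10StarCount`: |T₁^{(k)*}| = (d − 1)(1 − L^{−d})|T₁^{(k)}|

statement-level skeleton of published theorems with citation tags; proofs where landed; nothing here is a claim about the Yang–Mills mass gap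

CITATION HEADER (lean-in-tree rule 2026-08-18).  Source: T. Bałaban, *Ultraviolet stability of three-dimensional
lattice pure gauge field theories*, Commun. Math. Phys. **102** (1985) 255–275, doi:10.1007/bf01229380, bib
`Balaban1985UV3` (cell paper B10; held `paper:balaban1985-cmp102-uv-stability-3d`, journal page = PDF page + 254;
renders `run/shared/lean/pub/pub-balaban/b2b-balaban-ref1/pages/1985-cmp102-uv-stability-3d/…-p006-x2.png` (p. 260),
`…-p017-x2.png` (p. 271) read for this file).  The printed words:

* p. 260 [6], after (18): *"|Ω₁*| denotes the number of bonds belonging to Ω₁ minus the number of bonds in Ω₁^{(1)}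
  and minus the number of bonds in the axial gauge fixing set."* — a DEFINITION, formalised on the torus lattices of
  `…Setup`/`…TorusGeometry` as `B10StarCount.starCount` (p252029), with the whole-lattice value
  `B10StarCount.starCount_univ` / `starCount_univ_fine`: `L^d·|T₁^{(k)*}| = (d − 1)(L^d − 1)|T₁^{(k)}|`.
* p. 271 [17], (62): *"E^{(k)} = log σ₀|T₁^{(k)*}| + d(𝔤) log g_k|T₁^{(k)*}| + log Z^{(k)}(T₁^{(k)}, 1) +
  Σ_X 𝒫′_{k+1}(g_k, X, 1)."* — where the whole-lattice count `|T₁^{(k)*}|` enters the vacuum-energy constants; the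
  cell's `B10DagLeaf` (audit unit b10-g10) needs a LOWER count `s₀|T₁^{(k)}| ≤ |T₁^{(k)*}|`, s₀ > 0, and typed it as the
  labelled READER'S ITEM (R2) `B10DagLeaf.StarLower S s₀` — a hypothesis on the leaf system's step pieces, with the
  remark *"for Ω₁ = the whole unit 3-torus with N = |T₁^{(k)}| sites: 3N − 3N/L³ − (N − N/L³) = 2(1 − L⁻³)N, so the
  count gives s₀ = 2(1 − L⁻³)"* (docstring of `StarLower`), used by `B10DagLeaf.not_thm1Printed_of_leafSystems`,
  `…compact_thm2_not_thm1Printed`, `DagDischarged.not_b10_withTowerRuns10_of_leafSystems`, and inhabited so far only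
  in the model family `B10DagLeaf.logRun` (`logRun_starLower`, s₀ = 7/4 = 2(1 − 2⁻³)).

WHAT THIS FILE DOES (unit `lit-balaban-r07` gen 8, B10 reader/fold owner; theorems only, no definition, no named
fact, no `sorry`; value = kernel bookkeeping of the typed skeleton).  §1 the real, unit-lattice form of the count:
`|T₁^{(k)*}| = (d − 1)(1 − L^{−d})|T₁^{(k)}|` (`starCount_univ_real`; d = 3: `2(1 − L⁻³)|T₁^{(k)}|`), the positivity
of `s⋆ := (d − 1)(1 − L^{−d})` for `d ≥ 2`, and `7/4 ≤ 2(1 − L⁻³)` for `L ≥ 2`.  §2 **(R2) BY NAME**: for every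
`B10Assembly.LeafSystem` whose step pieces record, at each step `k < K`, the whole-lattice star count of SOME level of
the torus tower (`starT = starCount univ`) and whose `|T₁^{(k)}|` is the number of sites of the corresponding fine
lattice, `StarLower S s⋆` holds (`starLower_leaf`); monotonicity in `s₀`; d = 3: `StarLower S (2(1 − L⁻³))` and
`StarLower S (7/4)` — the latter UNIFORM in `L ≥ 2`, so a whole family of runs on different lattices shares it.
§3 consequently the negative edge of `B10DagLeaf` holds with (R2) no longer a hypothesis
(`not_thm1Printed_of_concreteStar`, `compact_thm2_not_thm1Printed_of_concreteStar`): only (R1) the unit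
configuration, (R3) `d(𝔤) ≥ d₀ > 0` and the occurrence of small bare couplings remain as labelled inputs.  Honest
scope: the identification of the abstract step pieces' `starT` / `sites` with the concrete counts is a hypothesis
(the leaf system only NAMES these reals); nothing of Bałaban's densities is asserted.
-/

namespace Literature.MathematicalPhysics.QuantumFieldTheory.Balaban1983to89.B10StarLower

open Finset
open Literature.MathematicalPhysics.QuantumFieldTheory.Balaban1983to89
open Literature.MathematicalPhysics.QuantumFieldTheory.Balaban1983to89.B10StarCount
open Literature.MathematicalPhysics.QuantumFieldTheory.Balaban1983to89.B10

/-! ## §1 The whole-lattice count in unit-lattice volume -/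

section Count

variable {P : Params} {j : ℕ}

/-- **`|T₁^{(k)*}| = (d − 1)(1 − L^{−d})·|T₁^{(k)}|`** — the p. 260 count for Ω₁ = the whole lattice, in the volume
of the FINE (unit) lattice `T^{(j)}` (`B10StarCount.starCount_univ_fine` divided by `L^d`; the blocks partition the fine
lattice, `|T^{(j)}| = L^d|T^{(j+1)}|`). [cite: Balaban1985UV3, p.260 (after (18)) + (62) p.271] -/
theorem starCount_univ_real (hj : j + 1 ≤ P.m + P.K) :
    (starCount (univ : Finset (Site P (j + 1))) : ℝ)
      = ((P.d : ℝ) - 1) * (1 - ((P.L : ℝ) ^ P.d)⁻¹) * Fintype.card (Site P j) := by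
  have hL0 : (0 : ℝ) < P.L := by exact_mod_cast P.L_pos
  have hLd : (0 : ℝ) < (P.L : ℝ) ^ P.d := by positivity
  have h := starCount_univ_fine (P := P) hj
  have h' : ((P.L : ℝ) ^ P.d) * (starCount (univ : Finset (Site P (j + 1))) : ℝ)
      = ((P.d : ℝ) - 1) * ((P.L : ℝ) ^ P.d - 1) * Fintype.card (Site P j) := by
    exact_mod_cast h
  have key : (starCount (univ : Finset (Site P (j + 1))) : ℝ)
      = ((P.d : ℝ) - 1) * ((P.L : ℝ) ^ P.d - 1) * Fintype.card (Site P j) / (P.L : ℝ) ^ P.d := by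
    rw [eq_div_iff hLd.ne', mul_comm]
    exact h'
  rw [key]
  field_simp

/-- d = 3 (Theorem 1, p. 257): **`|T₁^{(k)*}| = 2(1 − L⁻³)|T₁^{(k)}|`** — the value recorded in the docstring of
`B10DagLeaf.StarLower` («3N − 3N/L³ − (N − N/L³) = 2(1 − L⁻³)N»). [cite: Balaban1985UV3, p.260 (after (18)) + (62) p.271] -/
theorem starCount_univ_real_d3 (hd : P.d = 3) (hj : j + 1 ≤ P.m + P.K) :
    (starCount (univ : Finset (Site P (j + 1))) : ℝ)
      = 2 * (1 - ((P.L : ℝ) ^ 3)⁻¹) * Fintype.card (Site P j) := by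
  rw [starCount_univ_real hj, hd]
  norm_num

/-- The constant `s⋆ = (d − 1)(1 − L^{−d})` is positive as soon as `d ≥ 2` (`L ≥ 2` from `Params`). (elementary; serves
the hypothesis `0 < s₀` of `B10DagLeaf.not_thm1Printed_of_leafSystems`) [cite: Balaban1985UV3, p.260 (after (18))] -/
theorem sStar_pos (hd : 2 ≤ P.d) : 0 < ((P.d : ℝ) - 1) * (1 - ((P.L : ℝ) ^ P.d)⁻¹) := by
  have hd' : (2 : ℝ) ≤ P.d := by exact_mod_cast hd
  have hL : (2 : ℝ) ≤ P.L := by exact_mod_cast P.hL.2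
  have hd0 : P.d ≠ 0 := by omega
  have hLd : (2 : ℝ) ≤ (P.L : ℝ) ^ P.d :=
    calc (2 : ℝ) = 2 ^ 1 := by norm_num
      _ ≤ (2 : ℝ) ^ P.d := pow_le_pow_right₀ (by norm_num) (Nat.one_le_iff_ne_zero.mpr hd0)
      _ ≤ (P.L : ℝ) ^ P.d := pow_le_pow_left₀ (by norm_num) hL _
  have h1 : ((P.L : ℝ) ^ P.d)⁻¹ ≤ 1 / 2 := by
    rw [inv_eq_one_div]
    exact one_div_le_one_div_of_le (by norm_num) hLd
  exact mul_pos (by linarith) (by linarith)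

/-- `7/4 ≤ 2(1 − L⁻³)` for `L ≥ 2` — the model constant of `B10DagLeaf.logRun_starLower` (L = 2, equality) is a
lower bound UNIFORM in the block size. (elementary; serves `starLower_leaf_seven_fourths`) [cite: Balaban1985UV3, p.260 (after (18))] -/
theorem seven_fourths_le (L : ℝ) (hL : 2 ≤ L) : 7 / 4 ≤ 2 * (1 - (L ^ 3)⁻¹) := by
  have h8 : (8 : ℝ) ≤ L ^ 3 := by nlinarith [mul_nonneg (sub_nonneg.2 hL) (sub_nonneg.2 hL)]
  have h1 : (L ^ 3)⁻¹ ≤ 1 / 8 := by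
    rw [inv_eq_one_div]
    exact one_div_le_one_div_of_le (by norm_num) h8
  linarith

end Count

/-! ## §2 The reader's item (R2) `B10DagLeaf.StarLower` BY NAME -/

section Leaf

variable {C : B10Assembly.Consts} {T : TowerRun}

/-- `StarLower` is monotone (downward) in the constant: `|T₁^{(k)}| ≥ 0` (`TowerRun.sites_nonneg`). (elementary)
[cite: Balaban1985UV3, p.260 (after (18))] -/
theorem starLower_mono (S : B10Assembly.LeafSystem C T) {s₀ s₁ : ℝ} (h : B10DagLeaf.StarLower S s₀)
    (hle : s₁ ≤ s₀) : B10DagLeaf.StarLower S s₁ := fun k hk =>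
  (mul_le_mul_of_nonneg_right hle (T.sites_nonneg k)).trans (h k hk)

/-- **(R2) DISCHARGED FOR THE CONCRETE COUNT.**  Let `S` be a leaf system (over any `TowerRun`) whose step pieces
record, at every step `k < K`, the whole-lattice star count of p. 260 for the level `lev k` of a torus tower `P`
(`starT = |T₁^{(k)*}| = starCount univ`, coarse lattice `T^{(lev k + 1)}`), and whose `|T₁^{(k)}|` is the number of
sites of the fine lattice `T^{(lev k)}`.  Then `s⋆|T₁^{(k)}| ≤ |T₁^{(k)*}|` with `s⋆ = (d − 1)(1 − L^{−d})` — in fact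
with equality — i.e. `B10DagLeaf.StarLower S s⋆`. [cite: Balaban1985UV3, p.260 (after (18)) + (62) p.271] -/
theorem starLower_leaf {P : Params} (S : B10Assembly.LeafSystem C T) (lev : ℕ → ℕ)
    (hlev : ∀ (k : ℕ), k + 1 ≤ T.K → lev k + 1 ≤ P.m + P.K)
    (hT : ∀ (k : ℕ) (hk : k + 1 ≤ T.K),
      (S.steps k hk).P.starT = (starCount (univ : Finset (Site P (lev k + 1))) : ℝ))
    (hN : ∀ (k : ℕ), k + 1 ≤ T.K → T.sites k = Fintype.card (Site P (lev k))) :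
    B10DagLeaf.StarLower S (((P.d : ℝ) - 1) * (1 - ((P.L : ℝ) ^ P.d)⁻¹)) := by
  intro k hk
  rw [hT k hk, hN k hk, starCount_univ_real (hlev k hk)]

/-- d = 3: `StarLower S (2(1 − L⁻³))` for such leaf systems — the constant announced in the docstring of
`B10DagLeaf.StarLower`. [cite: Balaban1985UV3, p.260 (after (18)) + (62) p.271] -/
theorem starLower_leaf_d3 {P : Params} (hd : P.d = 3) (S : B10Assembly.LeafSystem C T) (lev : ℕ → ℕ)
    (hlev : ∀ (k : ℕ), k + 1 ≤ T.K → lev k + 1 ≤ P.m + P.K)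
    (hT : ∀ (k : ℕ) (hk : k + 1 ≤ T.K),
      (S.steps k hk).P.starT = (starCount (univ : Finset (Site P (lev k + 1))) : ℝ))
    (hN : ∀ (k : ℕ), k + 1 ≤ T.K → T.sites k = Fintype.card (Site P (lev k))) :
    B10DagLeaf.StarLower S (2 * (1 - ((P.L : ℝ) ^ 3)⁻¹)) := by
  have h := starLower_leaf S lev hlev hT hN
  rw [hd] at h
  convert h using 1
  norm_num

/-- d = 3, UNIFORMLY IN THE BLOCK SIZE: `StarLower S (7/4)` for such leaf systems (`7/4 ≤ 2(1 − L⁻³)`, `L ≥ 2`) — the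
constant of the model `B10DagLeaf.logRun_starLower`, now for every run whose step pieces carry the concrete count.
[cite: Balaban1985UV3, p.260 (after (18)) + (62) p.271] -/
theorem starLower_leaf_seven_fourths {P : Params} (hd : P.d = 3) (S : B10Assembly.LeafSystem C T) (lev : ℕ → ℕ)
    (hlev : ∀ (k : ℕ), k + 1 ≤ T.K → lev k + 1 ≤ P.m + P.K)
    (hT : ∀ (k : ℕ) (hk : k + 1 ≤ T.K),
      (S.steps k hk).P.starT = (starCount (univ : Finset (Site P (lev k + 1))) : ℝ))
    (hN : ∀ (k : ℕ), k + 1 ≤ T.K → T.sites k = Fintype.card (Site P (lev k))) :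
    B10DagLeaf.StarLower S (7 / 4) :=
  starLower_mono S (starLower_leaf_d3 hd S lev hlev hT hN)
    (seven_fourths_le (P.L : ℝ) (by exact_mod_cast P.hL.2))

/-- The leaf system's UPPER count `starT_le : |T₁^{(k)*}| ≤ 3|T₁^{(k)}|` (field of `B10Assembly.LeafSystem`, p. 260:
«T₁^{(k)*} ⊂ the bonds of the 3-torus») is CONSISTENT with the concrete count: at d = 3, `2(1 − L⁻³)|T| ≤ 3|T|`; in
general `(d − 1)(1 − L^{−d})|T| ≤ d|T|`. [cite: Balaban1985UV3, p.260 (after (18))] -/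
theorem starCount_univ_real_le {P : Params} {j : ℕ} (hj : j + 1 ≤ P.m + P.K) :
    (starCount (univ : Finset (Site P (j + 1))) : ℝ) ≤ (P.d : ℝ) * Fintype.card (Site P j) := by
  rw [starCount_univ_real hj]
  have hN : (0 : ℝ) ≤ Fintype.card (Site P j) := by positivity
  have hL0 : (0 : ℝ) < P.L := by exact_mod_cast P.L_pos
  have hinv : (0 : ℝ) ≤ ((P.L : ℝ) ^ P.d)⁻¹ := by positivity
  have hinv1 : ((P.L : ℝ) ^ P.d)⁻¹ ≤ 1 := by
    apply inv_le_one_of_one_le₀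
    exact one_le_pow₀ (by exact_mod_cast P.L_pos)
  have hd1 : (1 : ℝ) ≤ P.d := by exact_mod_cast P.hd
  apply mul_le_mul_of_nonneg_right _ hN
  nlinarith [mul_nonneg (sub_nonneg.2 hd1) hinv]

end Leaf

/-! ## §3 The negative edge of `B10DagLeaf` with (R2) discharged -/

section Families

variable {C : B10Assembly.Consts} {I : Type}

/-- **¬ THEOREM 1 IN THE ONE-SIDED (VERBATIM) READING, (R2) no longer a hypothesis.**  For a family of d = 3 runs
carrying leaf systems with common constants whose step pieces record the CONCRETE star counts of p. 260 (each run `i`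
on its own torus tower `P i`, `(P i).d = 3`, any block sizes `(P i).L ≥ 2`), the reader's items (R1) `UnitConfig0`,
(R3) `DgLower … d₀` (d₀ > 0) and arbitrarily small bare couplings: `¬ B10.Thm1Printed` — `B10DagLeaf.not_thm1Printed_of_leafSystems`
fed with `starLower_leaf_seven_fourths` (s₀ = 7/4 uniformly in `i`).  A statement about the TYPING `B10.Thm1Printed`
over located leaves, not about Bałaban's densities. [cite: Balaban1985UV3, Thm 1 p.257 + (62) p.271] -/
theorem not_thm1Printed_of_concreteStar (T : I → TowerRun) (S : ∀ i, B10Assembly.LeafSystem C (T i))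
    (P : I → Params) (hd3 : ∀ i, (P i).d = 3) (lev : I → ℕ → ℕ)
    (hlev : ∀ i (k : ℕ), k + 1 ≤ (T i).K → lev i k + 1 ≤ (P i).m + (P i).K)
    (hT : ∀ i (k : ℕ) (hk : k + 1 ≤ (T i).K),
      ((S i).steps k hk).P.starT = (starCount (univ : Finset (Site (P i) (lev i k + 1))) : ℝ))
    (hN : ∀ i (k : ℕ), k + 1 ≤ (T i).K → (T i).sites k = Fintype.card (Site (P i) (lev i k)))
    {d₀ : ℝ} (hd : 0 < d₀) (hU : ∀ i, B10DagLeaf.UnitConfig0 (T i)) (hD : ∀ i, B10DagLeaf.DgLower (S i) d₀)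
    (hsmall : B10DagLeaf.SmallBareOccur T) :
    ¬ Thm1Printed (fun i => (T i).toRunData) :=
  B10DagLeaf.not_thm1Printed_of_leafSystems T S hd (by norm_num : (0 : ℝ) < 7 / 4) hU
    (fun i => starLower_leaf_seven_fourths (hd3 i) (S i) (lev i) (hlev i) (hT i) (hN i)) hD hsmall

/-- Side by side, for the same families: `(B10.Thm1PrintedCompact ∧ B10.Thm2Printed) ∧ ¬ B10.Thm1Printed`
(`B10DagLeaf.compact_thm2_not_thm1Printed` with (R2) discharged). [cite: Balaban1985UV3, Thm 1 p.257 + Thm 2 p.272] -/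
theorem compact_thm2_not_thm1Printed_of_concreteStar (T : I → TowerRun) (S : ∀ i, B10Assembly.LeafSystem C (T i))
    (P : I → Params) (hd3 : ∀ i, (P i).d = 3) (lev : I → ℕ → ℕ)
    (hlev : ∀ i (k : ℕ), k + 1 ≤ (T i).K → lev i k + 1 ≤ (P i).m + (P i).K)
    (hT : ∀ i (k : ℕ) (hk : k + 1 ≤ (T i).K),
      ((S i).steps k hk).P.starT = (starCount (univ : Finset (Site (P i) (lev i k + 1))) : ℝ))
    (hN : ∀ i (k : ℕ), k + 1 ≤ (T i).K → (T i).sites k = Fintype.card (Site (P i) (lev i k)))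
    {d₀ : ℝ} (hd : 0 < d₀) (hU : ∀ i, B10DagLeaf.UnitConfig0 (T i)) (hD : ∀ i, B10DagLeaf.DgLower (S i) d₀)
    (hsmall : B10DagLeaf.SmallBareOccur T) :
    (Thm1PrintedCompact (fun i => (T i).toRunData) ∧ Thm2Printed (fun i => (T i).toRunData))
      ∧ ¬ Thm1Printed (fun i => (T i).toRunData) :=
  B10DagLeaf.compact_thm2_not_thm1Printed T S hd (by norm_num : (0 : ℝ) < 7 / 4) hU
    (fun i => starLower_leaf_seven_fourths (hd3 i) (S i) (lev i) (hlev i) (hT i) (hN i)) hD hsmall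

/-- The fine-lattice form (`B10DagLeaf.FineLattices S` in place of `SmallBareOccur T`). [cite: Balaban1985UV3, Thm 1 p.257 + (3) p.256] -/
theorem not_thm1Printed_of_concreteStar_fineLattices (T : I → TowerRun) (S : ∀ i, B10Assembly.LeafSystem C (T i))
    (P : I → Params) (hd3 : ∀ i, (P i).d = 3) (lev : I → ℕ → ℕ)
    (hlev : ∀ i (k : ℕ), k + 1 ≤ (T i).K → lev i k + 1 ≤ (P i).m + (P i).K)
    (hT : ∀ i (k : ℕ) (hk : k + 1 ≤ (T i).K),
      ((S i).steps k hk).P.starT = (starCount (univ : Finset (Site (P i) (lev i k + 1))) : ℝ))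
    (hN : ∀ i (k : ℕ), k + 1 ≤ (T i).K → (T i).sites k = Fintype.card (Site (P i) (lev i k)))
    {d₀ : ℝ} (hd : 0 < d₀) (hU : ∀ i, B10DagLeaf.UnitConfig0 (T i)) (hD : ∀ i, B10DagLeaf.DgLower (S i) d₀)
    (hfine : B10DagLeaf.FineLattices S) :
    ¬ Thm1Printed (fun i => (T i).toRunData) :=
  not_thm1Printed_of_concreteStar T S P hd3 lev hlev hT hN hd hU hD (B10DagLeaf.smallBare_of_fineLattices S hfine)

end Families

end Literature.MathematicalPhysics.QuantumFieldTheory.Balaban1983to89.B10StarLower
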